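import Literature.MathematicalPhysics.QuantumLattice.HubbardUVSymbolSmooth
import Mathlib.Analysis.Calculus.MeanValue
import HarnessLib

/-!
# The ultraviolet symbol of the counterterm carrier is GLOBALLY Lipschitz in the band value — the frame-SHIFT door at every scale

Topic `MathematicalPhysics/QuantumLattice`; cell gate-hubbard-kl, K3-FLOW S6 (plan g16 ruling F, KL STATUS 2026-08-27 l.2548): in the
flowing-dispersion scheme (Benfatto–Giuliani–Mastropietro 2006, (2.23): «`E_{h−1}(k) = E_h(k) + C_h^{−1}(k) n̂_h(k)`») the one-shot scale-`n`
covariance `C^{K_n}_{>Λ_n}` with symbol `Ψ_{e_{K_n}}(ω) = c·w(ω, e)/(−iω + e)`, `e = ξ − K_n(p)` (`uvSymbolFn`, `HubbardUVSymbolSmooth`), is compared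
with the one at the previous frame `K_{n−1}`; the shift `K_n − K_{n−1}` is tiny against `Λ_n`, but the frames themselves are NOT (`|K_n| ~ |U| ≫ Λ_n`
at deep scales), so the resummed door of `HubbardUVSymbolResummedLipschitz` (`|K| ≤ Λ/4`) does not apply — and is not needed: `Ψ` is differentiable
in `e` EVERYWHERE with `‖∂_eΨ‖ ≤ (2B₁+1)c/max(|ω|,Λ/2)²` (`norm_uvSymbolFnXiD1_le`), hence by the mean-value inequality

* `norm_uvSymbolFn_sub_le` — `‖Ψ_e(ω) − Ψ_{e′}(ω)‖ ≤ (2B₁+1)·c/max(|ω|, Λ/2)²·|e − e′|` for ALL `e, e′`;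
* `norm_uvSymbolFn_sub_le_unif` — `≤ 4(2B₁+1)·c/Λ²·|e − e′|`.

Everything is proved; no definitions; no named facts.

## Sources

G. Benfatto, A. Giuliani, V. Mastropietro, Ann. Henri Poincaré 7 (2006) 809–898, §2.2 (2.23), (2.36aa) [`BenfattoGiulianiMastropietro2006`].
-/

noncomputable section

namespace Literature.MathematicalPhysics.QuantumLattice

/-- **`Ψ` is globally `e`-Lipschitz**: `‖Ψ_e(ω) − Ψ_{e′}(ω)‖ ≤ (2B₁+1)·c/max(|ω|, Λ/2)²·|e − e′|` for ALL `e, e′` (mean-value inequality on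
`norm_uvSymbolFnXiD1_le`; no hypothesis relating the band values to the scale). [cite: BenfattoGiulianiMastropietro2006, §2.2 (2.36aa)] -/
theorem norm_uvSymbolFn_sub_le {c Λ : ℝ} (hΛ : 0 < Λ) (hc : 0 ≤ c) {B₁ : ℝ} (hB₁ : ∀ x, |deriv salmhoferCutoff x| ≤ B₁) (ω e e' : ℝ) :
    ‖uvSymbolFn c Λ e ω - uvSymbolFn c Λ e' ω‖ ≤ (2 * B₁ + 1) * c / max |ω| (Λ / 2) ^ 2 * |e - e'| := by
  rw [uvSymbolFn_eq_uvSymbolFnXi, uvSymbolFn_eq_uvSymbolFnXi]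
  have h := Convex.norm_image_sub_le_of_norm_hasDerivWithin_le (f := uvSymbolFnXi c Λ ω) (f' := uvSymbolFnXiD1 c Λ ω)
    (s := Set.univ) (fun x _ => (hasDerivAt_uvSymbolFnXi hΛ x).hasDerivWithinAt) (fun x _ => norm_uvSymbolFnXiD1_le hΛ hc hB₁ x)
    convex_univ (Set.mem_univ e') (Set.mem_univ e)
  rwa [Real.norm_eq_abs] at h

/-- **Uniform form**: `‖Ψ_e(ω) − Ψ_{e′}(ω)‖ ≤ 4(2B₁+1)·c/Λ²·|e − e′|` (`max(|ω|, Λ/2) ≥ Λ/2`). [cite: BenfattoGiulianiMastropietro2006, §2.2 (2.36aa)] -/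
theorem norm_uvSymbolFn_sub_le_unif {c Λ : ℝ} (hΛ : 0 < Λ) (hc : 0 ≤ c) {B₁ : ℝ} (hB₁ : ∀ x, |deriv salmhoferCutoff x| ≤ B₁) (ω e e' : ℝ) :
    ‖uvSymbolFn c Λ e ω - uvSymbolFn c Λ e' ω‖ ≤ 4 * ((2 * B₁ + 1) * c) / Λ ^ 2 * |e - e'| := by
  have hB10 : 0 ≤ B₁ := (abs_nonneg _).trans (hB₁ 0)
  refine (norm_uvSymbolFn_sub_le hΛ hc hB₁ ω e e').trans (mul_le_mul_of_nonneg_right ?_ (abs_nonneg _))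
  have hm : Λ / 2 ≤ max |ω| (Λ / 2) := le_max_right _ _
  have hm0 : 0 < max |ω| (Λ / 2) := lt_of_lt_of_le (by positivity) hm
  rw [div_le_div_iff₀ (by positivity) (by positivity)]
  have h2 : Λ ^ 2 ≤ 4 * max |ω| (Λ / 2) ^ 2 := by nlinarith
  have h3 : 0 ≤ (2 * B₁ + 1) * c := by positivity
  nlinarith [mul_le_mul_of_nonneg_left h2 h3]

end Literature.MathematicalPhysics.QuantumLattice

end
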